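import Mathlib
import Summits.Ventures.PercRepro2.UniversalFlow2Good
import Summits.Ventures.PercRepro2.UniversalDoubleBundle

/-! # (UH*) on the double bundles as series–parallel terms: `SP.bundle m ∧ SP.bundle K`
(seat mine-b, cell pub-perc-repro2; MINE-B.md §23.14)

UniversalDoubleBundle.lean proves (UH*) on the cube `Finset (Fin m) × Finset (Fin K)` with the bundle labels.
Here the configuration type of the term `SP.bundle n` (UniversalFlow2Good.lean: `bundle 0 = absent`,
`bundle (n+1) = par (bundle n) free`) is identified with `Fin n → Bool` (`bundleFunIso`, by `Fin.snoc`) and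
then with `Finset (Fin n)` (`boolFunFinsetIso`, the set of blue edges), the labels are the red / blue counts
(`SP.bundle_bLab`, `SP.bundle_rLab`), and `universal_transport` carries the theorem over:
**`SP.universal_doubleBundle`** — every double bundle `SP.bundle m ∧ SP.bundle K` satisfies (UH*). -/

namespace Summit.Ventures.PercRepro2.V2Closure

open Finset
open Summit.Ventures.PercRepro2.UHClosure

/-! ### the configurations of a bundle as boolean vectors -/

/-- the order isomorphism between the configurations of `SP.bundle n` and `Fin n → Bool` (`true` = blue) -/
def bundleFunIso : ∀ n : ℕ, (SP.bundle n).Conf ≃o (Fin n → Bool)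
  | 0 =>
    { toFun := fun _ => Fin.elim0
      invFun := fun _ => ()
      left_inv := fun _ => rfl
      right_inv := fun f => funext (fun i => Fin.elim0 i)
      map_rel_iff' := by
        intro a b
        constructor
        · intro _; exact le_rfl
        · intro _ i; exact Fin.elim0 i }
  | n + 1 =>
    let e := bundleFunIso n
    { toFun := fun p : (SP.bundle n).Conf × Bool => Fin.snoc (e p.1) p.2
      invFun := fun f => (e.symm (Fin.init f), f (Fin.last n))
      left_inv := fun p => by
        obtain ⟨c, b⟩ := p
        simp only [Fin.init_snoc, Fin.snoc_last, OrderIso.symm_apply_apply]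
      right_inv := fun f => by
        simp only [OrderIso.apply_symm_apply, Fin.snoc_init_self]
      map_rel_iff' := by
        intro p q
        simp only [Equiv.coe_fn_mk, Pi.le_def]
        constructor
        · intro hle
          refine ⟨?_, ?_⟩
          · rw [← e.le_iff_le, Pi.le_def]
            intro i
            have := hle (Fin.castSucc i)
            simpa only [Fin.snoc_castSucc] using this
          · show @LE.le Bool Bool.instLE p.2 q.2
            simpa only [Fin.snoc_last] using hle (Fin.last n)
        · rintro ⟨h1, h2⟩ i
          refine Fin.lastCases ?_ (fun j => ?_) i
          · have h2' : @LE.le Bool Bool.instLE p.2 q.2 := h2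
            simpa only [Fin.snoc_last] using h2'
          · simp only [Fin.snoc_castSucc]
            exact (e.le_iff_le.2 h1) j }

/-- the configurations of `SP.bundle (n+1)` are pairs (the term is `par (bundle n) free`) -/
theorem bundleFunIso_succ_apply (n : ℕ) (p : (SP.bundle n).Conf × Bool) :
    bundleFunIso (n + 1) p = Fin.snoc (bundleFunIso n p.1) p.2 := rfl

/-- the order isomorphism between `Fin n → Bool` and `Finset (Fin n)` (the set of `true` coordinates) -/
def boolFunFinsetIso (n : ℕ) : (Fin n → Bool) ≃o Finset (Fin n) where
  toFun f := univ.filter (fun i => f i = true)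
  invFun s := fun i => decide (i ∈ s)
  left_inv f := by
    funext i
    simp only [mem_filter, mem_univ, true_and]
    cases f i <;> simp
  right_inv s := by
    ext i
    simp only [mem_filter, mem_univ, true_and, decide_eq_true_eq]
  map_rel_iff' := by
    intro f g
    simp only [Equiv.coe_fn_mk, Finset.subset_iff, mem_filter, mem_univ, true_and, Pi.le_def]
    constructor
    · intro h i
      cases hf : f i
      · exact Bool.false_le _
      · rw [h hf]
    · intro h i hi
      have := h i
      rw [hi] at this
      exact Bool.eq_true_of_true_le this

/-- the composite: configurations of a bundle as finsets of blue edges -/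
def bundleIso (n : ℕ) : (SP.bundle n).Conf ≃o Finset (Fin n) := (bundleFunIso n).trans (boolFunFinsetIso n)

/-- the number of blue coordinates of a boolean vector -/
def blues {n : ℕ} (f : Fin n → Bool) : ℕ := (univ.filter (fun i => f i = true)).card

/-- the blue count of a snoc -/
theorem blues_snoc {n : ℕ} (f : Fin n → Bool) (b : Bool) :
    blues (Fin.snoc f b : Fin (n + 1) → Bool) = blues f + (if b then 1 else 0) := by
  unfold blues
  rw [Finset.card_filter, Finset.card_filter, Fin.sum_univ_castSucc]
  simp only [Fin.snoc_castSucc, Fin.snoc_last]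

/-- the blue label of a bundle configuration is its number of blue edges -/
theorem SP.bundle_bLab : ∀ (n : ℕ) (c : (SP.bundle n).Conf), (SP.bundle n).bLab c = blues (bundleFunIso n c)
  | 0, _ => by
      simp only [SP.bundle, SP.bLab, blues]
      rfl
  | n + 1, c => by
      obtain ⟨c₁, b⟩ := c
      have ih := SP.bundle_bLab n c₁
      show (SP.bundle n).bLab c₁ + SP.free.bLab b = blues (Fin.snoc (bundleFunIso n c₁) b)
      rw [blues_snoc, ih]
      cases b <;> rfl

/-- the red label of a bundle configuration is its number of red edges -/
theorem SP.bundle_rLab : ∀ (n : ℕ) (c : (SP.bundle n).Conf), (SP.bundle n).rLab c = n - blues (bundleFunIso n c)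
  | 0, _ => by
      simp only [SP.bundle, SP.rLab, blues]
      rfl
  | n + 1, c => by
      obtain ⟨c₁, b⟩ := c
      have ih := SP.bundle_rLab n c₁
      have hb := SP.bundle_bLab n c₁
      have hle : blues (bundleFunIso n c₁) ≤ n := by
        unfold blues; have := Finset.card_le_univ (univ.filter (fun i => bundleFunIso n c₁ i = true))
        rwa [Fintype.card_fin] at this
      show (SP.bundle n).rLab c₁ + SP.free.rLab b = n + 1 - blues (Fin.snoc (bundleFunIso n c₁) b)
      rw [blues_snoc, ih]
      cases b <;> simp only [SP.rLab, Bool.false_eq_true, if_false, if_true] <;> omega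

/-- the card of the finset of a bundle configuration is the blue count -/
theorem card_bundleIso (n : ℕ) (c : (SP.bundle n).Conf) : (bundleIso n c).card = blues (bundleFunIso n c) := rfl

/-! ### the double bundle -/

/-- the product isomorphism of two bundles with the cube of UniversalDoubleBundle.lean -/
def dbIso (m K : ℕ) : (SP.bundle m).Conf × (SP.bundle K).Conf ≃o Finset (Fin m) × Finset (Fin K) where
  toFun p := (bundleIso m p.1, bundleIso K p.2)
  invFun q := ((bundleIso m).symm q.1, (bundleIso K).symm q.2)
  left_inv p := by simp only [OrderIso.symm_apply_apply]
  right_inv q := by simp only [OrderIso.apply_symm_apply]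
  map_rel_iff' := by
    intro p q
    simp only [Equiv.coe_fn_mk, Prod.le_def, OrderIso.le_iff_le]

/-- the red label of the double bundle term is `dbR` along the isomorphism -/
theorem SP.rLab_doubleBundle (m K : ℕ) :
    (SP.ser (SP.bundle m) (SP.bundle K)).rLab = dbR m K ∘ (dbIso m K).symm.symm := by
  funext p
  obtain ⟨c, d⟩ := p
  show min ((SP.bundle m).rLab c) ((SP.bundle K).rLab d) = min (m - (bundleIso m c).card) (K - (bundleIso K d).card)
  rw [SP.bundle_rLab, SP.bundle_rLab, card_bundleIso, card_bundleIso]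

/-- the blue label of the double bundle term is `dbB` along the isomorphism -/
theorem SP.bLab_doubleBundle (m K : ℕ) :
    (SP.ser (SP.bundle m) (SP.bundle K)).bLab = dbB m K ∘ (dbIso m K).symm.symm := by
  funext p
  obtain ⟨c, d⟩ := p
  show min ((SP.bundle m).bLab c) ((SP.bundle K).bLab d) = min (bundleIso m c).card (bundleIso K d).card
  rw [SP.bundle_bLab, SP.bundle_bLab, card_bundleIso, card_bundleIso]

/-- **THEOREM: (UH*) holds on every double bundle `SP.bundle m ∧ SP.bundle K`.** -/
theorem SP.universal_doubleBundle (m K : ℕ) :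
    Universal (SP.ser (SP.bundle m) (SP.bundle K)).rLab (SP.ser (SP.bundle m) (SP.bundle K)).bLab := by
  rw [SP.rLab_doubleBundle, SP.bLab_doubleBundle]
  exact universal_transport (dbIso m K).symm _ _ (universal_doubleBundle' m K)

end Summit.Ventures.PercRepro2.V2Closure
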